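import Literature.MathematicalPhysics.QuantumFieldTheory.Balaban1983to89.B8Prop5ContractionKLevel

/-!
# `Balaban1983to89.B8Prop5PsiBounds` — T. Bałaban, *Spaces of regular gauge field configurations on a lattice and gauge fixing conditions*,
# Commun. Math. Phys. **99** (1985) 75–102 [Balaban1985RegularSpaces] ("B8"), Sect. D pp. 92–94: the size (1.98)R+(1.99) and the Lipschitz
# modulus (1.106) of the nonlinearity `Ψ = R(−Z)` of (1.100) ON THE ¼α₄-BALL, as standalone theorems (they are proved inside
# `B8Prop5ContractionKLevel.propFive_fixedPoint_kLevel`; exported here for the reality transfer `B8Prop5Reality` and for the joining corollary)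

statement-level skeleton of published theorems with citation tags; proofs where landed; nothing here is a claim about the
Yang–Mills mass gap

WHY THIS FILE (cell `pub-ymgap`, REBALANCE №41-b, seat `pub-ymgap-dag-n19-b` g2).  `B8LambdaSpaceKLevel.fixedPoint_kLevel_selfAdjoint`-type
transfers need the two quantitative hypotheses `hΨ0`/`hΨ1` of the contraction by name; `B8Prop5ContractionKLevel` (p427909) certifies them only
inside its main proof.  This file re-derives them as theorems (same proofs, same constants `Mc`, `Kc`), in a separate module to respect the
1000-line limit of the parent.  Nothing new is claimed.

WHAT THIS FILE PROVES (kernel, 0 sorry, theorems only): **`psiP5_bd2`** (`|Ψ(λ_s)|₍₋₂₎ ≤ M` on the ball), **`psiP5_sub_bd2`**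
(`|Ψ(λ_s) − Ψ(λ_t)|₍₋₂₎ ≤ K‖s − t‖` on the ball).  Count-neutral; N05 NOT discharged; nothing continuum / ℝ⁴ / OS / mass-gap / Clay.
Unit `pub-ymgap-dag-n19-b` (g2), 2026-08-26.
-/

noncomputable section

open NormedSpace Metric Set Filter Topology
open Complex (I)

namespace Literature.MathematicalPhysics.QuantumFieldTheory.Balaban1983to89.B8Prop5PsiBounds

open B7Prop1Explicit (e)
open B7Eq78Linearization (conjR)
open B8Ineq132 (covDerivFwd covDeriv)
open B8LambdaSpaceKLevel (wt lamSubK lamOf)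
open B8Prop5ContractionKLevel (Bd2 Bd2.neg Zsol Vop Wsrc Vop_sub norm_Vop_le norm_Vop_sub_Vop_le wt_sq_norm_Wsrc_le wt_sq_norm_Wsrc_sub_le PsiP5
  Mc Kc mWc KWc mWc_nonneg KWc_nonneg bd2_zsol bd2_zsol_sub_zsol)

-- `Site` alone could resolve to the torus sites of `Setup.lean`; re-export the `ℤ^d` sites of `B7Prop1Explicit`.
export B7Prop1Explicit (Site)

variable {d : ℕ} {𝔸 : Type*} [NormedRing 𝔸] [NormOneClass 𝔸] [NormedAlgebra ℂ 𝔸] [CompleteSpace 𝔸]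

/-! ## The size and the Lipschitz modulus of `Ψ` on the ball -/

section PsiBounds

variable {L k : ℕ} {η : ℝ} {Ω : ℕ → Set (Site d)} {Eb : ℕ → Set (Site d × Fin d)} {U₀ : Site d → Fin d → 𝔸ˣ}
  {A : Site d → Fin d → 𝔸} {DA : Site d → 𝔸}

/-- **(1.98)R + (1.99) for `Ψ = R(−Z)` on the ball** (the hypothesis `hΨ0` of `B8LambdaSpaceKLevel.fixedPoint_kLevel`, exported):
`|Ψ(λ_s)|₍₋₂₎ ≤ M` for `‖s‖ ≤ ¼α₄`. [cite: Balaban1985RegularSpaces, (1.98)–(1.99) pp.92–93] -/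
theorem psiP5_bd2 (hL : 1 ≤ L) (hη : 0 < η) (R gpar Eterm : (Site d → 𝔸) → (Site d → 𝔸))
    {α₄ BR a₁ b₁ cA cDA mE : ℝ}
    (hBR : 0 ≤ BR) (ha₁ : 0 ≤ a₁) (ha₁' : a₁ ≤ 1 / 24) (hb₁ : 0 < b₁) (hb₁' : b₁ ≤ 1 / 140)
    (hcA : 0 ≤ cA) (hcA' : cA ≤ 1 / 13) (hcDA : 0 ≤ cDA) (hmE : 0 ≤ mE) (hθ : 10 * a₁ * BR ≤ 1 / 2)
    (hRsub : ∀ f g : Site d → 𝔸, R (f - g) = R f - R g)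
    (hRbd : ∀ (f : Site d → 𝔸) (m : ℝ), 0 ≤ m → Bd2 L η k Ω f m → Bd2 L η k Ω (R f) (BR * m))
    (hg0 : ∀ s : lamSubK η U₀ L k Eb, ‖s‖ ≤ α₄ / 4 → ∀ j, j ≤ k → ∀ x ∈ Ω j, ‖gpar (lamOf s) x‖ ≤ a₁)
    (hg1 : ∀ s : lamSubK η U₀ L k Eb, ‖s‖ ≤ α₄ / 4 → ∀ j, j ≤ k → ∀ x ∈ Ω j, ∀ μ : Fin d,
      wt L η j * ‖covDerivFwd η U₀ μ (gpar (lamOf s)) x‖ ≤ b₁ ∧ wt L η j * ‖covDeriv η U₀ μ (gpar (lamOf s)) x‖ ≤ b₁)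
    (hE0 : ∀ s : lamSubK η U₀ L k Eb, ‖s‖ ≤ α₄ / 4 → Bd2 L η k Ω (Eterm (lamOf s)) mE)
    (hDA : Bd2 L η k Ω DA cDA)
    (hA : ∀ j, j ≤ k → ∀ x ∈ Ω j, ∀ μ : Fin d,
      wt L η j * ‖A x μ‖ ≤ cA ∧ wt L η j * ‖conjR (U₀ (x - e μ) μ)⁻¹ (A (x - e μ) μ)‖ ≤ cA)
    (s : lamSubK η U₀ L k Eb) (hs : ‖s‖ ≤ α₄ / 4) :
    Bd2 L η k Ω (PsiP5 η U₀ A DA R gpar Eterm (lamOf s)) (Mc d BR b₁ cA mE cDA) := by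
  have hmW : 0 ≤ mWc d b₁ cA mE cDA := mWc_nonneg hb₁.le hcA hmE hcDA
  have hcV : 0 ≤ 10 * a₁ := by positivity
  have ha12 : a₁ ≤ 1 / 12 := by linarith
  have hb70 : b₁ ≤ 1 / 70 := by linarith
  have hcA12 : cA ≤ 1 / 12 := by linarith
  have hVsub : ∀ f g : Site d → 𝔸, ∀ j, j ≤ k → ∀ x ∈ Ω j,
      Vop (gpar (lamOf s)) f x - Vop (gpar (lamOf s)) g x = Vop (gpar (lamOf s)) (f - g) x :=
    fun f g j hj x hx => Vop_sub f g ((hg0 s hs j hj x hx).trans ha12)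
  have hVbd : ∀ f : Site d → 𝔸, ∀ j, j ≤ k → ∀ x ∈ Ω j, ‖Vop (gpar (lamOf s)) f x‖ ≤ 10 * a₁ * ‖f x‖ :=
    fun f j hj x hx => norm_Vop_le f (hg0 s hs j hj x hx) ha12
  have hW : Bd2 L η k Ω (Wsrc η U₀ A DA (gpar (lamOf s)) (Eterm (lamOf s))) (mWc d b₁ cA mE cDA) :=
    fun j hj x hx => wt_sq_norm_Wsrc_le hL hη hb70 hcA hcA12 ((hg0 s hs j hj x hx).trans ha12) (hg1 s hs j hj x hx) (hA j hj x hx)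
      (hE0 s hs j hj x hx) (hDA j hj x hx)
  have hZ := bd2_zsol hL hη hVsub hVbd hRsub hRbd hW hcV hBR hmW hθ
  exact hRbd _ _ (by positivity) hZ.neg

/-- **(1.106) for `Ψ = R(−Z)` on the ball** (the hypothesis `hΨ1` of `B8LambdaSpaceKLevel.fixedPoint_kLevel`, exported):
`|Ψ(λ_s) − Ψ(λ_t)|₍₋₂₎ ≤ K‖s − t‖` for `‖s‖, ‖t‖ ≤ ¼α₄`. [cite: Balaban1985RegularSpaces, (1.104)–(1.106) p.94] -/
theorem psiP5_sub_bd2 (hL : 1 ≤ L) (hη : 0 < η) (R gpar Eterm : (Site d → 𝔸) → (Site d → 𝔸))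
    {α₄ BR a₁ b₁ cA cDA mE KE ℓ₀ ℓ₁ : ℝ}
    (hBR : 0 ≤ BR) (ha₁ : 0 ≤ a₁) (ha₁' : a₁ ≤ 1 / 24) (hb₁ : 0 < b₁) (hb₁' : b₁ ≤ 1 / 140)
    (hcA : 0 ≤ cA) (hcA' : cA ≤ 1 / 13) (hcDA : 0 ≤ cDA) (hmE : 0 ≤ mE) (hKE : 0 ≤ KE) (hℓ₀ : 0 ≤ ℓ₀) (hℓ₁ : 0 ≤ ℓ₁)
    (hθ : 10 * a₁ * BR ≤ 1 / 2)
    (hRsub : ∀ f g : Site d → 𝔸, R (f - g) = R f - R g)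
    (hRbd : ∀ (f : Site d → 𝔸) (m : ℝ), 0 ≤ m → Bd2 L η k Ω f m → Bd2 L η k Ω (R f) (BR * m))
    (hg0 : ∀ s : lamSubK η U₀ L k Eb, ‖s‖ ≤ α₄ / 4 → ∀ j, j ≤ k → ∀ x ∈ Ω j, ‖gpar (lamOf s) x‖ ≤ a₁)
    (hg1 : ∀ s : lamSubK η U₀ L k Eb, ‖s‖ ≤ α₄ / 4 → ∀ j, j ≤ k → ∀ x ∈ Ω j, ∀ μ : Fin d,
      wt L η j * ‖covDerivFwd η U₀ μ (gpar (lamOf s)) x‖ ≤ b₁ ∧ wt L η j * ‖covDeriv η U₀ μ (gpar (lamOf s)) x‖ ≤ b₁)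
    (hgL : ∀ s t : lamSubK η U₀ L k Eb, ‖s‖ ≤ α₄ / 4 → ‖t‖ ≤ α₄ / 4 → ∀ j, j ≤ k → ∀ x ∈ Ω j,
      ‖gpar (lamOf s) x - gpar (lamOf t) x‖ ≤ ℓ₀ * ‖s - t‖ ∧ ∀ μ : Fin d,
        wt L η j * ‖covDerivFwd η U₀ μ (gpar (lamOf s) - gpar (lamOf t)) x‖ ≤ ℓ₁ * ‖s - t‖ ∧
        wt L η j * ‖covDeriv η U₀ μ (gpar (lamOf s) - gpar (lamOf t)) x‖ ≤ ℓ₁ * ‖s - t‖)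
    (hE0 : ∀ s : lamSubK η U₀ L k Eb, ‖s‖ ≤ α₄ / 4 → Bd2 L η k Ω (Eterm (lamOf s)) mE)
    (hEL : ∀ s t : lamSubK η U₀ L k Eb, ‖s‖ ≤ α₄ / 4 → ‖t‖ ≤ α₄ / 4 → Bd2 L η k Ω (Eterm (lamOf s) - Eterm (lamOf t)) (KE * ‖s - t‖))
    (hDA : Bd2 L η k Ω DA cDA)
    (hA : ∀ j, j ≤ k → ∀ x ∈ Ω j, ∀ μ : Fin d,
      wt L η j * ‖A x μ‖ ≤ cA ∧ wt L η j * ‖conjR (U₀ (x - e μ) μ)⁻¹ (A (x - e μ) μ)‖ ≤ cA)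
    (s t : lamSubK η U₀ L k Eb) (hs : ‖s‖ ≤ α₄ / 4) (ht : ‖t‖ ≤ α₄ / 4) :
    Bd2 L η k Ω (PsiP5 η U₀ A DA R gpar Eterm (lamOf s) - PsiP5 η U₀ A DA R gpar Eterm (lamOf t))
      (Kc d BR b₁ cA mE cDA KE ℓ₀ ℓ₁ * ‖s - t‖) := by
  set mW := mWc d b₁ cA mE cDA with hmWdef
  have hmW : 0 ≤ mW := mWc_nonneg hb₁.le hcA hmE hcDA
  have hcV : 0 ≤ 10 * a₁ := by positivity
  have ha12 : a₁ ≤ 1 / 12 := by linarith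
  have hb70 : b₁ ≤ 1 / 70 := by linarith
  have hcA12 : cA ≤ 1 / 12 := by linarith
  have hVsub : ∀ s : lamSubK η U₀ L k Eb, ‖s‖ ≤ α₄ / 4 → ∀ f g : Site d → 𝔸, ∀ j, j ≤ k → ∀ x ∈ Ω j,
      Vop (gpar (lamOf s)) f x - Vop (gpar (lamOf s)) g x = Vop (gpar (lamOf s)) (f - g) x :=
    fun s hs f g j hj x hx => Vop_sub f g ((hg0 s hs j hj x hx).trans ha12)
  have hVbd : ∀ s : lamSubK η U₀ L k Eb, ‖s‖ ≤ α₄ / 4 → ∀ f : Site d → 𝔸, ∀ j, j ≤ k → ∀ x ∈ Ω j,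
      ‖Vop (gpar (lamOf s)) f x‖ ≤ 10 * a₁ * ‖f x‖ :=
    fun s hs f j hj x hx => norm_Vop_le f (hg0 s hs j hj x hx) ha12
  have hW : ∀ s : lamSubK η U₀ L k Eb, ‖s‖ ≤ α₄ / 4 → Bd2 L η k Ω (Wsrc η U₀ A DA (gpar (lamOf s)) (Eterm (lamOf s))) mW :=
    fun s hs j hj x hx => wt_sq_norm_Wsrc_le hL hη hb70 hcA hcA12 ((hg0 s hs j hj x hx).trans ha12) (hg1 s hs j hj x hx) (hA j hj x hx)
      (hE0 s hs j hj x hx) (hDA j hj x hx)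
  have hδ : 0 ≤ ‖s - t‖ := norm_nonneg _
  have hKW : 0 ≤ KWc d b₁ cA mE cDA KE ℓ₀ ℓ₁ := KWc_nonneg hb₁.le hcA hmE hcDA hKE hℓ₀ hℓ₁
  have hdW : Bd2 L η k Ω (Wsrc η U₀ A DA (gpar (lamOf s)) (Eterm (lamOf s)) - Wsrc η U₀ A DA (gpar (lamOf t)) (Eterm (lamOf t)))
      (KWc d b₁ cA mE cDA KE ℓ₀ ℓ₁ * ‖s - t‖) := by
    intro j hj x hx
    have h := wt_sq_norm_Wsrc_sub_le (U₀ := U₀) (A := A) (DA := DA) hL hη hb₁ hb₁' hcA hcA' (by positivity : 0 ≤ ℓ₀ * ‖s - t‖)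
      ((hg0 s hs j hj x hx).trans ha₁') ((hg0 t ht j hj x hx).trans ha₁') (hg1 s hs j hj x hx) (hg1 t ht j hj x hx) (hA j hj x hx)
      (hE0 t ht j hj x hx) (hDA j hj x hx) (hgL s t hs ht j hj x hx).1 (fun μ => (hgL s t hs ht j hj x hx).2 μ)
      (by simpa only [Pi.sub_apply] using hEL s t hs ht j hj x hx)
    rw [Pi.sub_apply]
    refine h.trans (le_of_eq ?_)
    unfold KWc; ring
  have hdV : ∀ g : Site d → 𝔸, ∀ j, j ≤ k → ∀ x ∈ Ω j,
      ‖Vop (gpar (lamOf s)) g x - Vop (gpar (lamOf t)) g x‖ ≤ 10 * ℓ₀ * ‖s - t‖ * ‖g x‖ := by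
    intro g j hj x hx
    have h := norm_Vop_sub_Vop_le g ((hg0 s hs j hj x hx).trans ha12) ((hg0 t ht j hj x hx).trans ha12)
    calc ‖Vop (gpar (lamOf s)) g x - Vop (gpar (lamOf t)) g x‖ ≤ 10 * ‖g x‖ * ‖gpar (lamOf s) x - gpar (lamOf t) x‖ := h
      _ ≤ 10 * ‖g x‖ * (ℓ₀ * ‖s - t‖) := by gcongr; exact (hgL s t hs ht j hj x hx).1
      _ = 10 * ℓ₀ * ‖s - t‖ * ‖g x‖ := by ring
  have hZZ := bd2_zsol_sub_zsol hL hη (hVsub s hs) (hVbd s hs) (hVsub t ht) (hVbd t ht) hRsub hRbd (hW s hs) (hW t ht) hcV hBR hmW hθ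
    (mul_nonneg hKW hδ) (by positivity : 0 ≤ 10 * ℓ₀ * ‖s - t‖) hdW hdV
  have h2c : 0 ≤ 2 * (KWc d b₁ cA mE cDA KE ℓ₀ ℓ₁ * ‖s - t‖ + 10 * ℓ₀ * ‖s - t‖ * (BR * (2 * mW))) := by positivity
  have hneg := hRbd _ _ h2c hZZ.neg
  intro j hj x hx
  have h := hneg j hj x hx
  have heq : (PsiP5 η U₀ A DA R gpar Eterm (lamOf s) - PsiP5 η U₀ A DA R gpar Eterm (lamOf t)) x =
      R (-(Zsol (Wsrc η U₀ A DA (gpar (lamOf s)) (Eterm (lamOf s))) (Vop (gpar (lamOf s))) R -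
        Zsol (Wsrc η U₀ A DA (gpar (lamOf t)) (Eterm (lamOf t))) (Vop (gpar (lamOf t))) R)) x := by
    simp only [PsiP5, Pi.sub_apply]
    rw [← Pi.sub_apply (R _) (R _), ← hRsub]
    congr 1
    funext y; simp only [Pi.sub_apply, Pi.neg_apply]; abel
  rw [heq]
  refine h.trans (le_of_eq ?_)
  unfold Kc; ring

end PsiBounds

#print axioms psiP5_bd2
#print axioms psiP5_sub_bd2

end Literature.MathematicalPhysics.QuantumFieldTheory.Balaban1983to89.B8Prop5PsiBounds

end
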